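import Mathlib

/-!
# `BalabanImbrieJaffe1984to88.BIJ85Sect7Statements` — T. Bałaban, J. Imbrie, A. Jaffe, *Renormalization of the Higgs model:
minimizers, propagators and the stability of mean field theory*, Commun. Math. Phys. **97** (1985) 299–329
[BalabanImbrieJaffe1985]: Sect. 7 "Positivity and Localization of the Effective Action" — **Theorem 7.1.1** (positivity of
σ_k, uniform in k), **Proposition 7.1.2** with its printed reduction argument (7.1.25)–(7.1.27) PROVED, the regularity and decay
statements (7.2.1)–(7.2.4), and the scalar-field stability estimate (7.3.1)–(7.3.2)

statement-level skeleton of published theorems with citation tags; proofs where landed; nothing here is a claim about the Yang–Mills mass gap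

PDF held: `paper:balaban1985-cmp97-bij-higgs-minimizers` (journal page = PDF page + 298).  Renders read as images: PDF pp. 23, 26,
27, 28 (journal 321, 324, 325, 326): `run/shared/lean/pub/pub-balaban/t4/b2b-balaban-t4-lit2/renders/bij1985/…-p023,p026,p027-x2.png`,
`run/shared/lean/pub/pub-balaban/b2b-balaban-beta-lit3-g10/pages/…-p028-x2.png`.

CITATION HEADER (lean-in-tree rule).  Part of the lit-balaban TYPED SKELETON (HOME `run/shared/lean/pub/lit-balaban/`; rows
C1.Thm7.1.1, C1.Prop7.1.2, C1.Eq7.2.1 … C1.Eq7.3.2 of `HOME/lit-balaban-r15/ROWS-C1-part2.md`).  WHAT IS REPRODUCED, and how.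
(a) **Theorem 7.1.1** p. 321 as `def Thm711 : Prop` over a FAMILY k ↦ (plaquette-field space, ‖·‖², the form ⟨f, σ_kf⟩): ∃ c > 0
BEFORE k ("independent of k").  (b) **Proposition 7.1.2** p. 324 as `def Prop712 : Prop` over a carrier of the momentum-fibre
data (the forms τ₀(p) ≤ τ₁(p), τ₂(p), the subspace ∂𝒦(p) and its complement, |p_j| ≤ π) — "(7.1.21) ⇒ Theorem 7.1.1" — and its
printed PROOF (7.1.25)–(7.1.27) KERNEL-CHECKED in the abstract form the page uses (`prop712_core`: from ⟨f,σf⟩ = ⟨f,τ₁f⟩ + ⟨f,τ₂f⟩,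
⟨f,τ₁f⟩ ≥ ε‖f^⊥‖², 0 ≤ ⟨f,τ₂f⟩, ⟨f,τ₂f⟩ ≥ ⟨∂B,τ₂∂B⟩ − 2M‖∂B‖‖f^⊥‖, ⟨∂B,τ₂∂B⟩ ≥ ε‖∂B‖², ‖f‖² = ‖f^⊥‖² + ‖∂B‖², one gets
⟨f,σf⟩ ≥ c‖f‖² with the printed c = ½δε, δ = min{1, (ε/2M)²} — a constant depending on ε and M only).  (c) **(7.2.1)–(7.2.4)**,
**(7.3.1)–(7.3.2)** as `def … : Prop` over kernel carriers, verbatim, with the printed attributions ((7.2.2) "is a consequence of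
Proposition 1.2 and the representation (1.103) of [6I]" = [Balaban1984PropagatorsI]; (7.2.3) "follows from the bound (2.157) in
[6II] and from the general theorem on unit lattice operators in [7]" = [Balaban1984PropagatorsII], [Balaban1983RegularityDecay];
(7.3.2) "can be proved by an extension of the proofs of [7]") recorded as DEPGRAPH edges, not Lean hypotheses.  NOTHING of the paper
is asserted beyond the kernel-checked real inequality.  Unit `lit-balaban-r15` (second reader of C1, Sects. 4–7).
-/

namespace Literature.MathematicalPhysics.QuantumFieldTheory.BalabanImbrieJaffe1984to88.BIJ85Sect7Statements

/-! ## Theorem 7.1.1 -/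

/-- Abstract carrier for Theorem 7.1.1 at one scale k: the space of unit-lattice plaquette fields f with ‖f‖² and the quadratic form
f ↦ ⟨f, σ_kf⟩ of (4.2.1)/(7.1.2) (periodic boundary conditions, p. 321). [cite: BalabanImbrieJaffe1985, (7.1.1) p.321] -/
structure SigmaForm where
  /-- plaquette fields -/
  Plaq : Type
  /-- ‖f‖² -/
  normSq : Plaq → ℝ
  /-- ⟨f, σ_k f⟩ -/
  sigma : Plaq → ℝ

/-- **Theorem 7.1.1** p. 321 [PDF 23], verbatim: *"7.1. Positivity of σ_k. Theorem 7.1.1. There exists a constant c > 0, independent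
of k, such that c ≤ σ_k. (7.1.1)"* — for the family k ↦ σ_k, read as the form inequality c‖f‖² ≤ ⟨f, σ_kf⟩ for every plaquette field f
(the sense in which the proof p. 324 concludes: "⟨f, σ_kf⟩ ≥ c(‖f^⊥‖² + ‖∂B‖²) = c‖f‖²"); c is chosen BEFORE k.  Printed proof: Sect.
7.1 pp. 321–325 via the momentum representation (7.1.2)–(7.1.20) and Proposition 7.1.2. [cite: BalabanImbrieJaffe1985, Thm. 7.1.1 p.321] -/
def Thm711 (fam : ℕ → SigmaForm) : Prop :=
  ∃ c : ℝ, 0 < c ∧ ∀ (k : ℕ) (f : (fam k).Plaq), c * (fam k).normSq f ≤ (fam k).sigma f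

/-! ## Proposition 7.1.2 and its printed proof -/

/-- **The argument (7.1.25)–(7.1.27)** p. 324 [PDF 26], KERNEL-CHECKED in the abstract form printed.  Verbatim: *"For f = ∂B + f^⊥ ∈
𝒦(p), write ⟨f,σ_kf⟩ = ⟨f,τ₁f⟩ + ⟨f,τ₂f⟩ = ⟨f^⊥,τ₁f^⊥⟩ + ⟨f,τ₂f⟩ ≥ ⟨f^⊥,τ₀f^⊥⟩ + ⟨f,τ₂f⟩ ≥ ε‖f^⊥‖² + ⟨f,τ₂f⟩. (7.1.25) Here we use
τ₁∂ = 0 and the hypothesis on τ₁. The idea is to bound ⟨f,τ₂f⟩ using the positivity of τ₂. In fact, 0 ≤ τ₂ is evident from (7.1.15).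
Then for any δ ∈ [0,1], ⟨f,σ_kf⟩ ≥ ε‖f^⊥‖² + δ⟨f,τ₂f⟩. (7.1.26) Note that by (7.1.24) and the positivity of τ₂, ⟨f,τ₂f⟩ = ⟨∂B,τ₂∂B⟩ +
⟨∂B,τ₂f^⊥⟩ + ⟨f^⊥,τ₂∂B⟩ + ⟨f^⊥,τ₂f^⊥⟩ ≥ ⟨∂B,τ₂∂B⟩ − 2M‖∂B‖‖f^⊥‖. For any λ > 0, we then have ⟨f,τ₂f⟩ ≥ ⟨∂B,τ₂∂B⟩ − (Mλ)²‖∂B‖² −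
λ^{−2}‖f^⊥‖². Use the lower bound (7.1.20) on τ₂↾∂𝒦, and choose λ so (Mλ)² = ε/2. Thus ⟨f,τ₂f⟩ ≥ ½ε‖∂B‖² − 2M²ε^{−1}‖f^⊥‖². Inserting
this in (7.1.26) yields ⟨f,σ_kf⟩ ≥ (ε − 2M²δε^{−1})‖f^⊥‖² + ½δε‖∂B‖² ≥ ½ε‖f^⊥‖² + ½δε‖∂B‖², (7.1.27) where the last inequality follows
for any δ < (ε/2M)² ≤ 1. Let δ > 0 and c ≡ ½δε > 0. Then ⟨f,σ_kf⟩ ≥ c(‖f^⊥‖² + ‖∂B‖²) = c‖f‖², as desired"*.  Here: `S` = ⟨f,σ_kf⟩,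
`T1` = ⟨f,τ₁f⟩ = ⟨f^⊥,τ₁f^⊥⟩, `T2` = ⟨f,τ₂f⟩, `Tcurl` = ⟨∂B,τ₂∂B⟩, `a` = ‖f^⊥‖, `b` = ‖∂B‖; conclusion with the explicit constant
c = ½·min{1,(ε/2M)²}·ε (for M > 0; the inequality δ ≤ (ε/2M)² suffices, strictness is not needed; the signs a, b ≥ 0 of the
norms are not even used).
[cite: BalabanImbrieJaffe1985, Prop. 7.1.2 (7.1.25)–(7.1.27) p.324] -/
theorem prop712_core {ε M a b S T1 T2 Tcurl : ℝ} (hε : 0 < ε) (hM : 0 < M)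
    (hS : S = T1 + T2) (hT1 : ε * a ^ 2 ≤ T1) (hT2pos : 0 ≤ T2) (hT2 : Tcurl - 2 * M * b * a ≤ T2)
    (hcurl : ε * b ^ 2 ≤ Tcurl) :
    (1 / 2) * min 1 ((ε / (2 * M)) ^ 2) * ε * (a ^ 2 + b ^ 2) ≤ S := by
  set δ : ℝ := min 1 ((ε / (2 * M)) ^ 2) with hδ
  have hδ1 : δ ≤ 1 := min_le_left _ _
  have hδ2 : δ ≤ (ε / (2 * M)) ^ 2 := min_le_right _ _
  have hδ0 : 0 ≤ δ := le_min zero_le_one (sq_nonneg _)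
  -- "For any λ > 0 … choose λ so (Mλ)² = ε/2": 2Mba ≤ (ε/2) b² + (2M²/ε) a²
  have hyoung : 2 * M * b * a ≤ (ε / 2) * b ^ 2 + (2 * M ^ 2 / ε) * a ^ 2 := by
    have h := sq_nonneg (ε * b - 2 * M * a)
    have hε' : 0 < 2 * ε := by linarith
    have key : (ε / 2) * b ^ 2 + (2 * M ^ 2 / ε) * a ^ 2 - 2 * M * b * a = (ε * b - 2 * M * a) ^ 2 / (2 * ε) := by
      field_simp
      ring
    have : 0 ≤ (ε * b - 2 * M * a) ^ 2 / (2 * ε) := div_nonneg h hε'.le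
    linarith
  -- "Thus ⟨f,τ₂f⟩ ≥ ½ε‖∂B‖² − 2M²ε⁻¹‖f^⊥‖²"
  have hT2' : (ε / 2) * b ^ 2 - (2 * M ^ 2 / ε) * a ^ 2 ≤ T2 := by linarith
  -- (7.1.26): S ≥ ε a² + δ T2 (uses T2 ≥ 0 and δ ≤ 1)
  have h726 : ε * a ^ 2 + δ * T2 ≤ S := by
    rw [hS]
    nlinarith
  -- (7.1.27): ≥ (ε − 2M²δ/ε) a² + ½δε b² ≥ ½ε a² + ½δε b²
  have hcoef : 2 * M ^ 2 * δ / ε ≤ ε / 2 := by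
    have h1 : 2 * M ^ 2 * δ / ε ≤ 2 * M ^ 2 * (ε / (2 * M)) ^ 2 / ε := by
      apply div_le_div_of_nonneg_right _ hε.le
      exact mul_le_mul_of_nonneg_left hδ2 (by positivity)
    have h2 : 2 * M ^ 2 * (ε / (2 * M)) ^ 2 / ε = ε / 2 := by
      field_simp
    linarith
  have h727 : (1 / 2) * ε * a ^ 2 + (1 / 2) * δ * ε * b ^ 2 ≤ S := by
    have hδT2 : δ * ((ε / 2) * b ^ 2 - (2 * M ^ 2 / ε) * a ^ 2) ≤ δ * T2 := mul_le_mul_of_nonneg_left hT2' hδ0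
    have ha2 : 0 ≤ a ^ 2 := sq_nonneg a
    have : (ε - 2 * M ^ 2 * δ / ε) * a ^ 2 ≥ (1 / 2) * ε * a ^ 2 := by nlinarith
    have e1 : ε * a ^ 2 + δ * ((ε / 2) * b ^ 2 - (2 * M ^ 2 / ε) * a ^ 2)
        = (ε - 2 * M ^ 2 * δ / ε) * a ^ 2 + (1 / 2) * δ * ε * b ^ 2 := by ring
    linarith
  -- "Let δ > 0 and c ≡ ½δε > 0. Then ⟨f,σ_kf⟩ ≥ c(‖f^⊥‖² + ‖∂B‖²)" (δ ≤ 1 gives ½ε ≥ ½δε on the a²-term)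
  have hfin : (1 / 2) * δ * ε * (a ^ 2 + b ^ 2) ≤ (1 / 2) * ε * a ^ 2 + (1 / 2) * δ * ε * b ^ 2 := by
    have h1 : (1 / 2) * ε * a ^ 2 * δ ≤ (1 / 2) * ε * a ^ 2 * 1 :=
      mul_le_mul_of_nonneg_left hδ1 (by positivity)
    have : (1 / 2) * δ * ε * a ^ 2 ≤ (1 / 2) * ε * a ^ 2 := by linarith [h1]
    linarith
  calc (1 / 2) * min 1 ((ε / (2 * M)) ^ 2) * ε * (a ^ 2 + b ^ 2) = (1 / 2) * δ * ε * (a ^ 2 + b ^ 2) := by rw [hδ]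
    _ ≤ S := hfin.trans h727

/-- The constant of `prop712_core` is positive ("c ≡ ½δε > 0"), and depends on ε, M only — whence "independent of k" in Theorem
7.1.1 once ε, M are. [cite: BalabanImbrieJaffe1985, Prop. 7.1.2 p.324] -/
theorem prop712_const_pos {ε M : ℝ} (hε : 0 < ε) (hM : 0 < M) : 0 < (1 / 2) * min 1 ((ε / (2 * M)) ^ 2) * ε := by
  have : 0 < min 1 ((ε / (2 * M)) ^ 2) := lt_min zero_lt_one (by positivity)
  positivity

/-- Abstract carrier for Proposition 7.1.2 (the momentum fibres of Sect. 7.1, pp. 321–324): for each scale k and momentum p with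
|p_j| ≤ π, the fibre space 𝒦(p) with ‖·‖², the orthogonal splitting f = ∂B + f^⊥ ((7.1.19), `normSqCurl` = ‖∂B‖², `normSqPerp` =
‖f^⊥‖²), and the quadratic forms ⟨f,σ_k(p)f⟩, ⟨f,τ₀(p)f⟩, ⟨f,τ₁(p)f⟩, ⟨f,τ₂(p)f⟩ of (7.1.14)–(7.1.19) restricted as printed; `sigmaFam`
re-packages σ_k for `Thm711`.  Carrier clauses (F6): the explicit formulas (7.1.2)–(7.1.20), τ₁∂ = 0, σ = τ₁ + τ₂, 0 ≤ τ₂, ‖τ₂‖ ≤ M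
(7.1.24) are properties of the instance (they are exactly the hypotheses of `prop712_core`). [cite: BalabanImbrieJaffe1985, Prop. 7.1.2 p.324] -/
structure FibreData where
  /-- momenta p with |p_j| ≤ π, per scale k -/
  Mom : ℕ → Type
  /-- the fibre 𝒦(p) -/
  Fib : (k : ℕ) → Mom k → Type
  /-- ‖f^⊥‖² -/
  normSqPerp : (k : ℕ) → (p : Mom k) → Fib k p → ℝ
  /-- ‖∂B‖² for f = ∂B + f^⊥ -/
  normSqCurl : (k : ℕ) → (p : Mom k) → Fib k p → ℝ
  /-- ⟨f^⊥, τ₀(p) f^⊥⟩ -/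
  tau0Perp : (k : ℕ) → (p : Mom k) → Fib k p → ℝ
  /-- ⟨∂B, τ₂(p) ∂B⟩ -/
  tau2Curl : (k : ℕ) → (p : Mom k) → Fib k p → ℝ
  /-- the family k ↦ σ_k (all momenta together) for Theorem 7.1.1 -/
  sigmaFam : ℕ → SigmaForm

/-- **(7.1.21)** p. 324 [PDF 26] at a given ε, verbatim: *"ε ≤ τ₀(p)↾(∂𝒦(p))^⊥ and ε ≤ τ₂(p)↾∂𝒦(p). (7.1.21)"* — as form inequalities
on the two summands of f = ∂B + f^⊥, for every k and |p_j| ≤ π. [cite: BalabanImbrieJaffe1985, (7.1.21) p.324] -/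
def Ineq7121 (F : FibreData) (ε : ℝ) : Prop :=
  ∀ (k : ℕ) (p : F.Mom k) (f : F.Fib k p),
    ε * F.normSqPerp k p f ≤ F.tau0Perp k p f ∧ ε * F.normSqCurl k p f ≤ F.tau2Curl k p f

/-- **Proposition 7.1.2** p. 324 [PDF 26], verbatim: *"Suppose there exists ε > 0, and τ₀(p) ≤ τ₁(p) such that for |p_j| ≤ π,
ε ≤ τ₀(p)↾(∂𝒦(p))^⊥ and ε ≤ τ₂(p)↾∂𝒦(p). (7.1.21) Then Theorem 7.1.1 holds."*  Typed reading: (∃ ε > 0, (7.1.21)) → `Thm711` for the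
family σ_k of the datum; "τ₀(p) ≤ τ₁(p)" and the standing facts of Sect. 7.1 are carrier clauses.  Printed proof = `prop712_core`.
[cite: BalabanImbrieJaffe1985, Prop. 7.1.2 p.324] -/
def Prop712 (F : FibreData) : Prop :=
  (∃ ε : ℝ, 0 < ε ∧ Ineq7121 F ε) → Thm711 F.sigmaFam

/-! ## (7.2.1)–(7.2.4): regularity and decay of H_k, C^{(k)}, D_k -/

/-- Abstract carrier for Sect. 7.2 at scale k: η-lattice points x (T_η) and unit-lattice points y (T₁^{(k)}), directions, the
kernel H_{k,μν}(x; y) of the Landau minimizer (7.2.1) with its gradient ∇H and distances, the kernel C^{(k)}_{μν}(x, y), and the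
kernel D_k(x, b) of (7.2.4). [cite: BalabanImbrieJaffe1985, (7.2.1) p.325] -/
structure KernelData where
  /-- x ∈ T_η -/
  SiteEta : Type
  /-- y ∈ T₁^{(k)} -/
  SiteU : Type
  /-- unit-lattice bonds b -/
  BondU : Type
  /-- directions μ, ν -/
  Dir : Type
  /-- |x − y| (x ∈ T_η, y ∈ T₁^{(k)}) -/
  distEU : SiteEta → SiteU → ℝ
  /-- |x − x′| on T_η -/
  distEta : SiteEta → SiteEta → ℝ
  /-- |x − y| on T₁^{(k)} -/
  distU : SiteU → SiteU → ℝ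
  /-- dist(x, b) -/
  distEB : SiteEta → BondU → ℝ
  /-- H_{k,μν}(x; y) -/
  H : Dir → Dir → SiteEta → SiteU → ℝ
  /-- |∇H_{k,μν}(x, y)| -/
  gradH : Dir → Dir → SiteEta → SiteU → ℝ
  /-- |∇H_{k,μν}(x, y) − ∇H_{k,μν}(x′, y)| -/
  gradHDiff : Dir → Dir → SiteEta → SiteEta → SiteU → ℝ
  /-- C^{(k)}_{μν}(x, y) -/
  C : Dir → Dir → SiteU → SiteU → ℝ
  /-- D_k(x, b) -/
  D : SiteEta → BondU → ℝ

namespace KernelData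

variable (K : KernelData)

/-- **(7.2.2)** p. 325 [PDF 27], verbatim: *"The minimizer H_k can be expressed as an integral kernel. For x ∈ T_η, (H_kB)_μ(x) =
Σ_{y∈T₁^{(k)},ν} H_{k,μν}(x; y)B_ν(y). (7.2.1) The kernel H_{k,μν}(x,y) and its gradient decay exponentially. In particular there exists
δ > 0 and for 0 ≤ α < 1 a constant M = M(α) < ∞ such that for |x − x′| ≤ 1, |H_{k,μν}(x,y)| + |∇H_{k,μν}(x,y)| +
|x − x′|^{−α}|∇H_{k,μν}(x,y) − ∇H_{k,μν}(x′,y)| ≤ Me^{−δ|x−y|}. (7.2.2) This inequality is a consequence of Proposition 1.2 and the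
representation (1.103) of [6I]."* — typed for a family k ↦ kernels: ∃ δ > 0, ∀ α ∈ [0,1), ∃ M, ∀ k, the display (x ≠ x′ for the
Hölder quotient). [cite: BalabanImbrieJaffe1985, (7.2.2) p.325] -/
def Ineq722 (fam : ℕ → KernelData) : Prop :=
  ∃ δ : ℝ, 0 < δ ∧ ∀ α : ℝ, 0 ≤ α → α < 1 → ∃ M : ℝ, ∀ (k : ℕ) (μ ν : (fam k).Dir) (x x' : (fam k).SiteEta)
    (y : (fam k).SiteU), x ≠ x' → (fam k).distEta x x' ≤ 1 →
      |(fam k).H μ ν x y| + (fam k).gradH μ ν x y + ((fam k).distEta x x') ^ (-α) * (fam k).gradHDiff μ ν x x' y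
        ≤ M * Real.exp (-(δ * (fam k).distEU x y))

/-- **(7.2.3)** p. 325 [PDF 27], verbatim: *"The unit lattice propagator C^{(k)} also has exponential decay, |C^{(k)}_{μν}(x,y)| ≤
Me^{−δ|x−y|}, (7.2.3) for x, y ∈ T₁^{(k)}. This inequality follows from the bound (2.157) in [6II] and from the general theorem on unit
lattice operators in [7]. In fact this inequality also holds for propagators with Dirichlet boundary conditions outside a domain Λ,
uniformly in Λ."* — at constants (M, δ) for one k. [cite: BalabanImbrieJaffe1985, (7.2.3) p.325] -/
def Ineq723 (M δ : ℝ) : Prop :=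
  ∀ (μ ν : K.Dir) (x y : K.SiteU), |K.C μ ν x y| ≤ M * Real.exp (-(δ * K.distU x y))

/-- **(7.2.4)** p. 326 [PDF 28], verbatim: *"The gauge transformation λ in (5.1.1) is bounded and depends on B through an exponentially
decaying kernel D_k: λ(x) = (D_kB)(x), |D_k(x, b)| ≤ Me^{−δdist(x,b)}. (7.2.4) This estimate follows from (5.1.4) and (7.2.2)."* — the
kernel bound at constants (M, δ). [cite: BalabanImbrieJaffe1985, (7.2.4) p.326] -/
def Ineq724 (M δ : ℝ) : Prop :=
  ∀ (x : K.SiteEta) (b : K.BondU), |K.D x b| ≤ M * Real.exp (-(δ * K.distEB x b))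

end KernelData

/-! ## (7.3.1)–(7.3.2): positivity of Δ_k(u_k) -/

/-- Abstract carrier for Sect. 7.3 at scale k: unit-lattice plaquettes, bonds and sites of T₁^{(k)}, the U(1) field v (|v(∂p) − 1|),
the background u_k(b) acting on scalar values, unit-lattice scalar fields φ with |φ(x)|² and |u_k(b)φ(b₊) − φ(b₋)|², the form
⟨φ, Δ_k(u_k)φ⟩ of (4.6.4), and e_k. [cite: BalabanImbrieJaffe1985, (7.3.2) p.326] -/
structure ScalarStabData where
  /-- plaquettes of T₁^{(k)} -/
  Plaq : Type
  /-- bonds of T₁^{(k)} -/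
  Bond : Type
  /-- sites of T₁^{(k)} -/
  Site : Type
  [bondFin : Fintype Bond]
  [siteFin : Fintype Site]
  /-- scalar fields φ -/
  Scalar : Type
  /-- e_k -/
  ek : ℝ
  /-- p ↦ |v(∂p) − 1| -/
  plaqDev : Plaq → ℝ
  /-- (φ, b) ↦ |u_k(b)φ(b₊) − φ(b₋)|² -/
  covDiffSq : Scalar → Bond → ℝ
  /-- (φ, x) ↦ |φ(x)|² -/
  absSq : Scalar → Site → ℝ
  /-- φ ↦ ⟨φ, Δ_k(u_k)φ⟩ -/
  deltaForm : Scalar → ℝ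

namespace ScalarStabData

variable (D : ScalarStabData)

/-- plumbing (API for the carrier of Sect. 7.3): finiteness of the bonds. [cite: BalabanImbrieJaffe1985, (7.3.2) p.326] -/
instance instBondFin : Fintype D.Bond := D.bondFin

/-- plumbing (API for the carrier of Sect. 7.3): finiteness of the sites. [cite: BalabanImbrieJaffe1985, (7.3.2) p.326] -/
instance instSiteFin : Fintype D.Site := D.siteFin

/-- **(7.3.1)** p. 326 [PDF 28] at exponent 𝓅, verbatim: *"In particular, let us assume that for the unit lattice field v, |v(∂p) − 1| ≤
e_k𝓅(e_k), (7.3.1) where 𝓅(e_k) = (1 + ln e_k^{−1})^𝓅."* [cite: BalabanImbrieJaffe1985, (7.3.1) p.326] -/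
def Hyp731 (pexp : ℝ) : Prop :=
  ∀ p : D.Plaq, D.plaqDev p ≤ D.ek * (1 + Real.log (D.ek⁻¹)) ^ pexp

/-- **(7.3.2)** p. 326 [PDF 28] at constants (γ, α, M), verbatim: *"Then the stability estimate can be stated in two forms. For constants
γ > 0, α > 0, M < ∞, ⟨φ, Δ_k(u_k)φ⟩ ≥ γΣ_{b∈T₁^{(k)}}|u_k(b)φ(b₊) − φ(b₋)|² − Me_k^{2−α}Σ_{x∈T₁^{(k)}}|φ(x)|². (7.3.2) The second form of
the inequality substitutes v_b for u_k(b) in the covariant derivative of φ. These inequalities can be proved by an extension of the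
proofs of [7]."* — the first form; NO printed proof ("can be proved by an extension of the proofs of [7]").
[cite: BalabanImbrieJaffe1985, (7.3.2) p.326] -/
def Ineq732 (γ α M : ℝ) : Prop :=
  ∀ φ : D.Scalar,
    γ * (∑ b : D.Bond, D.covDiffSq φ b) - M * D.ek ^ (2 - α) * (∑ x : D.Site, D.absSq φ x) ≤ D.deltaForm φ

/-- The printed claim of Sect. 7.3 as an implication at the stated quantifier shape: "For constants γ > 0, α > 0, M < ∞" (chosen
before k and the configuration), (7.3.1) ⇒ (7.3.2), for a family of data (k, v, u_k). [cite: BalabanImbrieJaffe1985, (7.3.1)–(7.3.2) p.326] -/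
def Claim73 {I : Type} (pexp : ℝ) (fam : I → ScalarStabData) : Prop :=
  ∃ γ α M : ℝ, 0 < γ ∧ 0 < α ∧ ∀ i : I, (fam i).Hyp731 pexp → (fam i).Ineq732 γ α M

end ScalarStabData

end Literature.MathematicalPhysics.QuantumFieldTheory.BalabanImbrieJaffe1984to88.BIJ85Sect7Statements
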